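import Summits.CriticalPhenomena.CardyFormulaZ2.Theorems.CardyComplexConeEdgePrecompactUFRSJunctionFunnelRef

/-!
# The junction funnel, part G: the funnel for one datum from the arch of the gate
(line `qkz-strip-boundary-arm` of crux `CardyComplexCone.EdgePrecompact`, stmt-CriticalPhenomena-11387;
seventh file of the registered sub-goal S2 = `ufrs_junctionFunnel`, lead c5, wave 4; registered
anchor `datum_funnel_JF`; continues `…UFRSJunctionFunnelRef.lean`)

`datum_funnel_JF` — for `ℤ²`-admissible rectangle data `F`, a rotation frame `ψ` with the
reference box of `F` in the position of the gate geometry (flat side or corner, chirality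
`s = ±1`, scale `N`, depth `h`: boundary row within `h - 1` of `0`, far sides beyond `4N + h + 2`,
at a corner the near column within `h - 1` of `0`), the colours of the boundary sites met by the
arch (wired on the side of the open path, free on the side of the dual path, pulled back along
`ψ`), and the arch as produced by `gate_read_JF` (`…UFRSJunctionFunnelGateRead.lean`): every
stretch of an orbit of `nextCorner (F.bcBondConfig ω)` through inner faces of `F` joining the
sup-ball of radius `2N - 1` about the frame origin to sup-distance `≥ 4N + h + 3` visits the
physical gate corner `(ψ⁻¹ v₀, k₀ - j)`. Proof: unfold the reference regions of the gate into
linear facts and check the hypotheses of `ref_funnel_JF` (positions of the arch against the box,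
colours of the box vertices of the open path and of an endpoint of every edge crossed by the
dual path, the two feet on opposite sides of the inner columns).

References: S. Smirnov, C. R. Acad. Sci. Paris 333 (2001), §2; H. Kesten, Comm. Math. Phys. 109
(1987), §2.
-/

set_option linter.unusedVariables false

namespace Summit.CriticalPhenomena.CardyFormulaZ2.Cruxes.EdgePrecompact.QkzStripBoundaryArm

open MeasureTheory Filter Set Metric
open scoped Topology BigOperators Pointwise
open Literature.Probability.LatticeModels Literature.Probability.Percolation
open Literature.Probability.RandomPlanarGeometry (DobrushinDomain)
open Summit.CriticalPhenomena.CardyFormulaZ2.Theses.CardyComplexCone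

noncomputable section

/-! ## The funnel for one datum from the arch of the gate -/

/-- Coordinates of the lower endpoint of the edge separating two adjacent faces: it is a corner
of both. -/
theorem sepLo_coord_JF {f f' : Site 2} (h : (zdGraph 2).Adj f f') :
    (f 0 ≤ sepLo f f' 0 ∧ sepLo f f' 0 ≤ f 0 + 1 ∧ f 1 ≤ sepLo f f' 1 ∧ sepLo f f' 1 ≤ f 1 + 1) ∧
      (f' 0 ≤ sepLo f f' 0 ∧ sepLo f f' 0 ≤ f' 0 + 1 ∧ f' 1 ≤ sepLo f f' 1 ∧ sepLo f f' 1 ≤ f' 1 + 1) := by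
  rw [adj_iff_coord_JF] at h
  simp only [sepLo, Pi.sup_apply]
  omega

/-- **The funnel for one datum, from the arch of the gate read in the frame.** `ℤ²`-admissible data
`F` of an open rectangle, a rotation frame `ψ = σ ∘ (· - n)` with reference box `[I₀, I₁] × [J₀, J₁]`
of `F` (`hbox`, `hbdry`) in the position of the gate geometry (`corner`, chirality `s = ±1`,
scale `N`, depth `h`: the boundary row `J₀` within `h - 1` of `0`, the far sides beyond
`4N + h + 2`, at a corner also the near column within `h - 1` of `0`), the colours of the boundary
sites met by the arch (wired on the side of the open path, free on the side of the dual path,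
pulled back along `ψ`), and the arch as produced by `gate_read_JF`. Then every stretch of an orbit
of `nextCorner (F.bcBondConfig ω)` through inner faces of `F` joining the sup-ball of radius
`2N - 1` about `n` to sup-distance `≥ 4N + h + 3` from `n` visits the physical gate corner
`(ψ⁻¹ v₀, k₀ - j)` (by `ref_funnel_JF`, after checking the positions of the arch against the box). -/
theorem datum_funnel_JF : ∀ (F : DiscreteDobrushin) (x₀ x₁ y₀ y₁ : ℝ), F.IsZdAdmissible → F.Ω = Set.Ioo x₀ x₁ ×ℂ Set.Ioo y₀ y₁ → ∀ (π : Equiv.Perm (Fin 2)) (ε : Fin 2 → ℤˣ) (j : Fin 4) (n : Site 2), (∀ k, Site.signedPerm π ε (cornerUnit k) = cornerUnit (k + j)) → ∀ (N h : ℕ), h ≤ N → 1 ≤ h → ∀ (s : ℤ), (s = 1 ∨ s = -1) → ∀ (corner : Bool) (I₀ I₁ J₀ J₁ : ℤ), (∀ z : Site 2, ((zdShiftIso (-n)).trans (zdSignedPermIso π ε)).symm z ∈ meshVertices F.Ω F.δ ↔ (I₀ ≤ z 0 ∧ z 0 ≤ I₁ ∧ J₀ ≤ z 1 ∧ z 1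 ≤ J₁)) → (∀ z : Site 2, ((zdShiftIso (-n)).trans (zdSignedPermIso π ε)).symm z ∈ F.zdBoundary ↔ (I₀ ≤ z 0 ∧ z 0 ≤ I₁ ∧ J₀ ≤ z 1 ∧ z 1 ≤ J₁) ∧ (z 0 = I₀ ∨ z 0 = I₁ ∨ z 1 = J₀ ∨ z 1 = J₁)) → (-(h : ℤ) + 1 ≤ J₀ ∧ J₀ ≤ h - 1) → 4 * (N : ℤ) + h + 2 ≤ J₁ → (corner = false → I₀ ≤ -(4 * (N : ℤ) + h + 2) ∧ 4 * (N : ℤ) + h + 2 ≤ I₁) → (corner = true → s = 1 → -(h : ℤ) + 1 ≤ I₀ ∧ I₀ ≤ h - 1 ∧ 4 * (N : ℤ) + h + 2 ≤ I₁) → (corner = true → s = -1 → -(h : ℤ) + 1 ≤ I₁ ∧ I₁ ≤ h - 1 ∧ I₀ ≤ -(4 * (N : ℤ) + h + 2)) → (corner = false → ∀ x : ℤ, 2 * (N : ℤ) - h ≤ s * x → s * x ≤ 4 * N + h → ((zdShiftIso (-n)).trans (zdSignedPermIso π ε)).symm ![x, J₀] ∉ F.zdArcB) → (corner = false → ∀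 x : ℤ, 2 * (N : ℤ) - h ≤ -s * x → -s * x ≤ 4 * N + h → ((zdShiftIso (-n)).trans (zdSignedPermIso π ε)).symm ![x, J₀] ∉ F.zdArcA) → (corner = true → s = 1 → ∀ y : ℤ, 2 * (N : ℤ) - h ≤ y → y ≤ 4 * N + h → ((zdShiftIso (-n)).trans (zdSignedPermIso π ε)).symm ![I₀, y] ∉ F.zdArcB) → (corner = true → s = -1 → ∀ y : ℤ, 2 * (N : ℤ) - h ≤ y → y ≤ 4 * N + h → ((zdShiftIso (-n)).trans (zdSignedPermIso π ε)).symm ![I₁, y] ∉ F.zdArcB) → (corner = true → ∀ x : ℤ, 2 * (N : ℤ) - h ≤ s * x → s * x ≤ 4 * N + h → ((zdShiftIso (-n)).trans (zdSignedPermIso π ε)).symm ![x, J₀] ∉ F.zdArcA) → ∀ (ω : BondConfig (Site 2)) (v₀ u g : Site 2) (k₀ : Fin 4) (P : (zdGraph 2).Walk v₀ u) (Q : (zdGraph 2).Walk (cFace (v₀, k₀)) g), (∀ e ∈ P.edges, e ∈ BondConfig.relabel (sym2Equiv ((zdShiftIso (-n)).trans (zdSignedPermIso π ε)).toEquiv)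 ω) → (∀ d ∈ Q.darts, sepEdge d.fst d.snd ∉ BondConfig.relabel (sym2Equiv ((zdShiftIso (-n)).trans (zdSignedPermIso π ε)).toEquiv) ω) → (∀ z ∈ P.support, ∃ z' ∈ ufrsGateRA corner N h, z 0 = s * z' 0 ∧ z 1 = z' 1) → (∃ u' ∈ ufrsGateFA corner N h, u 0 = s * u' 0 ∧ u 1 = u' 1) → (∀ f ∈ Q.support, ∃ f' ∈ ufrsGateRB corner N h, 2 * f 0 = 2 * s * f' 0 - (1 - s) ∧ f 1 = f' 1) → (∃ g' ∈ ufrsGateFB corner N h, 2 * g 0 = 2 * s * g' 0 - (1 - s) ∧ g 1 = g' 1) → ∀ (c : Site 2 × Fin 4) (i j' : ℕ), i ≤ j' → (∀ t, i ≤ t → t ≤ j' → F.IsInnerFace (cFace (cornerOrbit (F.bcBondConfig ω) c t))) → ((-(2 * (N : ℤ) - 1) ≤ ((cornerOrbit (F.bcBondConfig ω) c i).1 - n) 0 ∧ ((cornerOrbit (F.bcBondConfig ω) c i).1 - n) 0 ≤ 2 * N - 1 ∧ -(2 * (N : ℤ) - 1) ≤ ((cornerOrbit (F.bcBondConfig ω)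 c i).1 - n) 1 ∧ ((cornerOrbit (F.bcBondConfig ω) c i).1 - n) 1 ≤ 2 * N - 1) ∧ (4 * (N : ℤ) + h + 3 ≤ |((cornerOrbit (F.bcBondConfig ω) c j').1 - n) 0| ∨ 4 * (N : ℤ) + h + 3 ≤ |((cornerOrbit (F.bcBondConfig ω) c j').1 - n) 1|)) ∨ ((4 * (N : ℤ) + h + 3 ≤ |((cornerOrbit (F.bcBondConfig ω) c i).1 - n) 0| ∨ 4 * (N : ℤ) + h + 3 ≤ |((cornerOrbit (F.bcBondConfig ω) c i).1 - n) 1|) ∧ (-(2 * (N : ℤ) - 1) ≤ ((cornerOrbit (F.bcBondConfig ω) c j').1 - n) 0 ∧ ((cornerOrbit (F.bcBondConfig ω) c j').1 - n) 0 ≤ 2 * N - 1 ∧ -(2 * (N : ℤ) - 1) ≤ ((cornerOrbit (F.bcBondConfig ω) c j').1 - n) 1 ∧ ((cornerOrbit (F.bcBondConfig ω) c j').1 - n) 1 ≤ 2 * N - 1)) → ∃ s', i ≤ s' ∧ s' ≤ j' ∧ cornerOrbit (F.bcBondConfig ω) c s' = (((zdShiftIso (-n)).trans (zdSignedPermIso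 π ε)).symm v₀, k₀ - j) := by
  intro F x₀ x₁ y₀ y₁ hF hFΩ π ε j n hrot N h hhN h1 s hs corner I₀ I₁ J₀ J₁ hbox hbdry hJ₀ hJ₁ hIflat hIc1 hIc2 hcolA hcolB hcolA1 hcolA2 hcolB' ω v₀ u g k₀ P Q hPω hQω hPR huF hQR hgF c i j' hij hin hends
  set Ψ : zdGraph 2 ≃g zdGraph 2 := (zdShiftIso (-n)).trans (zdSignedPermIso π ε) with hΨ
  -- unfold the reference regions once and for all, as linear facts
  have hRA : ∀ z ∈ P.support, (corner = false → (2 * (N : ℤ) ≤ s * z 0 ∧ s * z 0 ≤ 4 * N ∧ -(h : ℤ) ≤ z 1 ∧ z 1 ≤ 4 * N) ∨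
      (-(4 * (N : ℤ)) ≤ z 0 ∧ z 0 ≤ 4 * N ∧ 2 * (N : ℤ) ≤ z 1 ∧ z 1 ≤ 4 * N)) ∧
      (corner = true → -(h : ℤ) ≤ s * z 0 ∧ s * z 0 ≤ 4 * N ∧ 2 * (N : ℤ) ≤ z 1 ∧ z 1 ≤ 4 * N) := by
    intro z hz
    obtain ⟨z', hz', h0, h1⟩ := hPR z hz
    have hsz : s * z 0 = z' 0 := by rw [h0]; rcases hs with rfl | rfl <;> ring
    constructor
    · intro hc; subst hc
      rcases hz' with hz' | hz' <;> [left; right] <;> rcases hs with rfl | rfl <;> omega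
    · intro hc; subst hc
      change -(h : ℤ) ≤ z' 0 ∧ z' 0 ≤ 4 * N ∧ (2 * N : ℤ) ≤ z' 1 ∧ z' 1 ≤ 4 * N at hz'
      omega
  have hRB : ∀ f ∈ Q.support, (corner = false → (s = 1 → -(4 * (N : ℤ)) ≤ f 0 ∧ f 0 + 1 ≤ -(2 * (N : ℤ))) ∧
      (s = -1 → 2 * (N : ℤ) ≤ f 0 ∧ f 0 + 1 ≤ 4 * N)) ∧
      (corner = true → (s = 1 → 2 * (N : ℤ) ≤ f 0 ∧ f 0 + 1 ≤ 4 * N) ∧ (s = -1 → -(4 * (N : ℤ)) ≤ f 0 ∧ f 0 + 1 ≤ -(2 * (N : ℤ)))) ∧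
      (-(h : ℤ) - 1 ≤ f 1 ∧ f 1 ≤ 4 * N) := by
    intro f hf
    obtain ⟨f', hf', h0, h1⟩ := hQR f hf
    cases corner
    · change -(4 * N : ℤ) ≤ f' 0 ∧ f' 0 + 1 ≤ -(2 * N : ℤ) ∧ -(h : ℤ) - 1 ≤ f' 1 ∧ f' 1 ≤ 4 * N at hf'
      refine ⟨fun _ => ⟨fun hs1 => ?_, fun hs1 => ?_⟩, fun hc => absurd hc (by decide), by omega⟩ <;> subst hs1 <;> omega
    · change (2 * N : ℤ) ≤ f' 0 ∧ f' 0 + 1 ≤ 4 * N ∧ -(h : ℤ) - 1 ≤ f' 1 ∧ f' 1 ≤ 4 * N at hf'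
      refine ⟨fun hc => absurd hc (by decide), fun _ => ⟨fun hs1 => ?_, fun hs1 => ?_⟩, by omega⟩ <;> subst hs1 <;> omega
  have hv₀P := hRA v₀ P.start_mem_support
  have hf₀Q := hRB _ Q.start_mem_support
  obtain ⟨⟨a0, a1, -, -⟩, ⟨b0, b1, -, -⟩⟩ := vertex_coord_JF v₀ k₀
  -- the foot of `P` and the foot face of `Q`
  have hu' : ¬ (I₀ ≤ u 0 ∧ u 0 ≤ I₁ ∧ J₀ ≤ u 1 ∧ u 1 ≤ J₁) := by
    obtain ⟨u', hu', h0, h1⟩ := huF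
    cases corner
    · change (2 * N : ℤ) ≤ u' 0 ∧ u' 0 ≤ 4 * N ∧ u' 1 = -(h : ℤ) at hu'
      omega
    · change u' 0 = -(h : ℤ) ∧ (2 * N : ℤ) ≤ u' 1 ∧ u' 1 ≤ 4 * N at hu'
      rcases hs with rfl | rfl
      · have := hIc1 rfl rfl; rw [one_mul] at h0; omega
      · have := hIc2 rfl rfl; omega
  have hg' : g 1 < J₀ := by
    obtain ⟨g', hg', h0, h1⟩ := hgF
    cases corner
    · change -(4 * N : ℤ) ≤ g' 0 ∧ g' 0 + 1 ≤ -(2 * N : ℤ) ∧ g' 1 = -(h : ℤ) - 1 at hg'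
      omega
    · change (2 * N : ℤ) ≤ g' 0 ∧ g' 0 + 1 ≤ 4 * N ∧ g' 1 = -(h : ℤ) - 1 at hg'
      omega
  -- boundary sites pulled back: off the boundary means off both arcs
  have hoffA : ∀ z : Site 2, Ψ.symm z ∉ F.zdBoundary → Ψ.symm z ∉ F.zdArcA := fun z hz hA => hz (F.zdArcA_subset_zdBoundary hA)
  have hoffB : ∀ z : Site 2, Ψ.symm z ∉ F.zdBoundary → Ψ.symm z ∉ F.zdArcB := fun z hz hB => hz (F.zdArcB_subset_zdBoundary hB)
  have hv₀y : (2 * N : ℤ) ≤ v₀ 1 := by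
    cases corner
    · rcases hv₀P.1 rfl with hp | hb
      · exfalso
        rcases hs with rfl | rfl
        · have := (hf₀Q.1 rfl).1 rfl; omega
        · have := (hf₀Q.1 rfl).2 rfl; omega
      · exact hb.2.2.1
    · exact (hv₀P.2 rfl).2.2.1
  refine ref_funnel_JF F x₀ x₁ y₀ y₁ hF hFΩ π ε j n hrot I₀ I₁ J₀ J₁ N (4 * N + h + 1) (by omega) (by omega) (by omega)
    (by omega) hbox ω v₀ u g k₀ P Q hv₀y ?_ ?_ hPω ?_ ?_ hu' hQω ?_ ?_ hg' ?_ c i j' hij hin ?_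
  · -- `v₀` in the box
    cases corner
    · have := hIflat rfl
      rcases hv₀P.1 rfl with hp | hb <;> rcases hs with rfl | rfl <;> omega
    · have hb := hv₀P.2 rfl
      rcases hs with rfl | rfl
      · have := hIc1 rfl rfl; have := (hf₀Q.2.1 rfl).1 rfl; omega
      · have := hIc2 rfl rfl; have := (hf₀Q.2.1 rfl).2 rfl; omega
  · -- the face of the gate corner is a face of the box
    cases corner
    · have := hIflat rfl
      rcases hs with rfl | rfl
      · have := (hf₀Q.1 rfl).1 rfl; omega
      · have := (hf₀Q.1 rfl).2 rfl; omega
    · have hb := hv₀P.2 rfl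
      rcases hs with rfl | rfl
      · have := hIc1 rfl rfl; have := (hf₀Q.2.1 rfl).1 rfl; omega
      · have := hIc2 rfl rfl; have := (hf₀Q.2.1 rfl).2 rfl; omega
  · -- region of `P`
    intro z hz
    have hz' := hRA z hz
    cases corner
    · rcases hz'.1 rfl with hp | hb <;> rcases hs with rfl | rfl <;> omega
    · have := hz'.2 rfl
      rcases hs with rfl | rfl <;> omega
  · -- colours of the box vertices of `P`: off the free arc
    intro z hz hzb
    by_cases hbd : Ψ.symm z ∈ F.zdBoundary
    · have hside := ((hbdry z).1 hbd).2
      have hz' := hRA z hz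
      rw [show z = ![z 0, z 1] from by rw [Site.eq_iff_two]; simp]
      cases corner
      · have := hIflat rfl
        rcases hz'.1 rfl with hp | hb
        · rcases hs with rfl | rfl <;>
          · have hz1 : z 1 = J₀ := by omega
            rw [hz1]
            exact hcolA rfl (z 0) (by omega) (by omega)
        · exfalso; omega
      · have hb := hz'.2 rfl
        rcases hs with rfl | rfl
        · have := hIc1 rfl rfl
          have hz0 : z 0 = I₀ := by omega
          rw [hz0]
          exact hcolA1 rfl rfl (z 1) (by omega) (by omega)
        · have := hIc2 rfl rfl
          have hz0 : z 0 = I₁ := by omega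
          rw [hz0]
          exact hcolA2 rfl rfl (z 1) (by omega) (by omega)
    · exact hoffB z hbd
  · -- region of `Q`
    intro f hf
    have hf' := hRB f hf
    cases corner
    · have := hIflat rfl
      rcases hs with rfl | rfl
      · have := (hf'.1 rfl).1 rfl; omega
      · have := (hf'.1 rfl).2 rfl; omega
    · rcases hs with rfl | rfl
      · have := hIc1 rfl rfl; have := (hf'.2.1 rfl).1 rfl; omega
      · have := hIc2 rfl rfl; have := (hf'.2.1 rfl).2 rfl; omega
  · -- colours of the edges crossed by `Q`: an endpoint off the wired arc
    intro d hd
    refine ⟨sepLo d.fst d.snd, Sym2.mem_mk_left _ _, ?_⟩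
    by_cases hbd : Ψ.symm (sepLo d.fst d.snd) ∈ F.zdBoundary
    · have hside := ((hbdry _).1 hbd).2
      obtain ⟨hc1, -⟩ := sepLo_coord_JF d.adj
      have hf' := hRB _ (Q.dart_fst_mem_support_of_mem_darts hd)
      rw [show sepLo d.fst d.snd = ![sepLo d.fst d.snd 0, sepLo d.fst d.snd 1] from by rw [Site.eq_iff_two]; simp]
      cases corner
      · have := hIflat rfl
        have hy : sepLo d.fst d.snd 1 = J₀ := by
          rcases hs with rfl | rfl
          · have := (hf'.1 rfl).1 rfl; omega
          · have := (hf'.1 rfl).2 rfl; omega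
        rw [hy]
        rcases hs with rfl | rfl
        · have := (hf'.1 rfl).1 rfl
          exact hcolB rfl _ (by omega) (by omega)
        · have := (hf'.1 rfl).2 rfl
          exact hcolB rfl _ (by omega) (by omega)
      · have hy : sepLo d.fst d.snd 1 = J₀ := by
          rcases hs with rfl | rfl
          · have := hIc1 rfl rfl; have := (hf'.2.1 rfl).1 rfl; omega
          · have := hIc2 rfl rfl; have := (hf'.2.1 rfl).2 rfl; omega
        rw [hy]
        rcases hs with rfl | rfl
        · have := (hf'.2.1 rfl).1 rfl
          exact hcolB' rfl _ (by omega) (by omega)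
        · have := (hf'.2.1 rfl).2 rfl
          exact hcolB' rfl _ (by omega) (by omega)
    · exact hoffA _ hbd
  · -- the two feet are on opposite sides of the inner columns
    intro z hz hzb f hf X hX1 hX2 hX3 hX4
    have hz' := hRA z hz
    have hf' := hRB f hf
    cases corner
    · have := hIflat rfl
      rcases hs with rfl | rfl
      · have := (hf'.1 rfl).1 rfl
        rcases hz'.1 rfl with hp | hb <;> omega
      · have := (hf'.1 rfl).2 rfl
        rcases hz'.1 rfl with hp | hb <;> omega
    · have hb := hz'.2 rfl
      rcases hs with rfl | rfl
      · have := hIc1 rfl rfl; have := (hf'.2.1 rfl).1 rfl; omega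
      · have := hIc2 rfl rfl; have := (hf'.2.1 rfl).2 rfl; omega
  · -- the ends of the stretch
    exact hends

end

end Summit.CriticalPhenomena.CardyFormulaZ2.Cruxes.EdgePrecompact.QkzStripBoundaryArm
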